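import Literature.NumberTheory.Automorphic.RamakrishnanCuspidalityOnlyIf
import Literature.NumberTheory.Automorphic.GelbartJacquetSymmSquare
import Literature.NumberTheory.Automorphic.BaseChangeCyclicCuspidal
import Literature.NumberTheory.Automorphic.BaseChangeInductionAlongProofs
import HarnessLib

/-!
# Ramakrishnan (2000), Theorem M: the Existence clause for twist-equivalent and dihedral pairs
# (Lemma 3.1.1 (III): `π ⊠ (π ⊗ χ) = (sym²(π) ⊗ χ) ⊞ ωχ`; (II): `π ⊠ π' = I_K^F(π_K ⊗ μ)`),
# and Theorem M from the leaves

Fourth sibling proof file (theorems only; no `sorry`, no definition, no named fact) of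
`Literature.NumberTheory.Automorphic.RamakrishnanTensorProductGL2`, whose named fact
`Ramakrishnan2000_theoremM` renders D. Ramakrishnan, *Modularity of the Rankin–Selberg `L`-series,
and multiplicity one for `SL(2)`*, Ann. of Math. (2) **152** (2000), 45–111 [Ramakrishnan2000],
**Theorem M** (§3), at the level of Satake parameters almost everywhere; sequel to
`RamakrishnanCuspidalityOnlyIf` (the "only if" half (R2) of the cuspidality criterion from the
Jacquet–Shalika leaves).

After `RamakrishnanTheoremMProofs` and `RamakrishnanCuspidalityOnlyIf`, what separates
`Ramakrishnan2000_theoremM` from the cuspidal-case fact `Ramakrishnan2000_boxTimes_cuspidal` and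
the standard leaves is the **Existence clause (R1)**: for *every* cuspidal pair `(π, π')` on
`GL(2)/F` an automorphic `Π` on `GL(4)/F` with `t_Π = t_π ⊗ t_{π'}` a.e. The printed proof is
op. cit. **Lemma 3.1.1** (preprint `paper:galaxy-pdf-4279542020`, pp. 13–14), verbatim:

> "Lemma 3.1.1. Theorem M holds in the following three special cases: (I) At least one of
> `{π, π'}` is not cuspidal. (II) At least one of `{π, π'}` is automorphically induced by a
> character `μ` of (the idele class group of) a quadratic extension `K` of `F`. (III) `π'` is a
> twist of `π`, i.e., there exists a character `χ` of `C_F` such that `π' ≃ π ⊗ χ`. […] It is left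
> to consider (III). In this case, we set `π ⊠ π' = (sym²(π) ⊗ χ) ⊞ ωχ`, where `ω` is the central
> character of `π`. The asserted identities are then consequences of the work of Gelbart and
> Jacquet ([GJ]) and the strong multiplicity one theorem ([JS2])."

together with the isobaric sum `⊞` of op. cit. §2.2, **Theorem 2.2.4** ([JS2], "by the theory of
Eisenstein series, one has a sum operation `⊞` ([La3])", preprint pp. 9–10):

> "Given any `m`-tuple of cuspidal representations `π₁, …, π_m` of `GL(n₁, 𝔸_F), …, GL(n_m, 𝔸_F)`
> respectively, there exists a unitary, irreducible, automorphic representation `π₁ ⊞ ⋯ ⊞ π_m` of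
> `GL(n, 𝔸_F)`, `n = n₁ + ⋯ + n_m`, which is unique up to equivalence, such that for any finite
> set `S` of places, `L^S(s, ⊞ⱼ πⱼ) = ∏ⱼ L^S(s, πⱼ)`."

## What is proved, and modulo what

* `satakeTensor_pair_twist` — the local identity of case (III) at an unramified place:
  `{a, b} ⊗ χ(ϖ){a, b} = χ(ϖ) Sym²{a, b} + {χ(ϖ) ab}`, i.e. `t_π ⊗ t_{π ⊗ χ} =
  t_{sym²(π) ⊗ χ} ⊔ t_{ωχ}` (`ω(ϖ_v) = ab = ∏ t_{π,v}`).
* `exists_isobaricPair_of_isobaricSum` — the binary case of the isobaric-sum hypothesis (below)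
  from its `Fin k`-family form (bookkeeping only).
* `Ramakrishnan2000_theoremM.existence_of_isSatakeTwistBy` — **Lemma 3.1.1 (III)** in the tree's
  rendering: for cuspidal `π` on `GL(2)/F` with no a.e. self-twist by the quadratic character of
  any quadratic `K/F` (`¬ IsQuadraticSelfTwistAE`, the tree's unramified shadow of "not
  automorphically induced from a quadratic extension", so that the Gelbart–Jacquet lift
  `sym²(π)` is cuspidal on `GL(3)/F` — `GelbartJacquet_symmSq_cuspidal`, Gelbart–Jacquet 1978
  Thm. (9.3)) and `π' ≃ π ⊗ χ` on Satake parameters a.e. (`IsSatakeTwistBy`), there is an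
  automorphic `Π` on `GL(4)/F` with `t_{Π,v} = t_{π,v} ⊗ t_{π',v}` a.e., namely
  `(sym²(π) ⊗ χ) ⊞ (χω)` — the twist by `χ` is the proved
  `CuspidalAutomorphicRepData.exists_twist_hecke_hasSatakeParamAt`, the Satake shadow `Ω` of the
  central character `ω` (`Ω(ϖ_v) = ∏ t_{π,v}`) is `exists_heckeCharacter_prod_satake_of_sSup_irreducible`
  (granting the Borel–Jacquet dictionary leaves `exists_isAssociatedL2`, `hasSatakeParamAt_iff_L2`,
  `stable_cuspidal_eq_sSup_irreducible`, exactly as in `RamakrishnanCuspidalityOnlyIf`), the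
  representation `χω` of `GL(1)/F` is the proved
  `exists_automorphicRepData_hasSatakeParamAt_valueAtUniformizer`, and the isobaric sum
  `GL(3) ⊞ GL(1) → GL(4)` is the hypothesis `hIso`.
* `Ramakrishnan2000_theoremM.existence_of_leaves` — **(R1) by the case distinction of Lemma
  3.1.1**: either some quadratic `K/F` makes `π` or `π'` an a.e. `ε_{K/F}`-self-twist — case (II),
  the hypothesis `hDihedral` — or not, and then either `π' ≃ π ⊗ χ` for some `χ` — case (III),
  the previous theorem — or `(π, π')` is of general type and `Ramakrishnan2000_boxTimes_cuspidal`
  gives a (cuspidal) `Π`.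
* `Ramakrishnan2000_theoremM.of_leaves` — **Theorem M** from `Ramakrishnan2000_boxTimes_cuspidal`,
  `GelbartJacquet_symmSq_cuspidal`, the hypotheses `hIso`, `hDihedral`, Jacquet–Shalika (2.2)/(2.3)
  for Borel–Jacquet data and the Borel–Jacquet dictionary (`of_boxTimes_cuspidal_of_leaves` of
  `RamakrishnanCuspidalityOnlyIf` with (R1) discharged by `existence_of_leaves`).

**The two hypotheses stated inline** (no named fact is introduced; neither has a carrier in the
tree — "the tree has no induced / isobaric representations", cf. `KimExteriorSquareGL4`,
`PairLFunctionPolesRepData`, `BaseChangeInductionAlong`):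

* `hIso` — **isobaric sums of cuspidal data exist** (Theorem 2.2.4 above; R. P. Langlands, *On the
  notion of an automorphic representation*, Corvallis 1979, Prop. 2: an irreducible constituent
  of a representation induced from cuspidal data `σ` of a Levi `M(𝔸)` is an automorphic
  representation, i.e. an irreducible subquotient of the space of automorphic forms — which is
  what `AutomorphicRepData` records; Borel–Jacquet 1979, 4.6), rendered on Satake parameters in
  the shape of the isobaric clause of `Kim2003_exteriorSquare_GL4`: for cuspidal Borel–Jacquet
  data `σᵢ` on `GL_{mᵢ}(𝔸_F)`, `∑ mᵢ = n`, some automorphic `Π` on `GL_n(𝔸_F)` has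
  `t_{Π,v} = ⊎ᵢ t_{σᵢ,v}` for almost all `v`. It is asserted for cuspidal data of arbitrary
  central characters (Langlands' Prop. 2 has no unitarity hypothesis on `σ`; Theorem 2.2.4 is its
  unitary case with the uniqueness of [JS2], which is not used).
* `hDihedral` — **Lemma 3.1.1 (II)** in the tree's rendering: if some quadratic `K/F` makes `π` or
  `π'` an a.e. self-twist by `ε_{K/F}` (`IsQuadraticSelfTwistAE`, the shadow of "automorphically
  induced by a character `μ` of a quadratic extension `K`", Labesse–Langlands), then `π ⊠ π'`
  exists (op. cit.: "`π ⊠ π' = I_K^F(π_K ⊗ μ)`", base change and automorphic induction,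
  Prop. 2.3.1). Its reduction to the tree's base-change / automorphic-induction facts
  (`exists_baseChange_cyclic`, `automorphicInduction_cyclic`, `automorphicInduction_character`)
  needs, besides `hIso`, the characterisation of `ε_{K/F}`-self-twists as automorphic inductions,
  which the tree states only in the `L²` model (`ArthurClozel1989_inducedLift_of_twist_eq`); it is
  not attempted here.

## Lemma 3.1.1 (II): one dihedral member (`π ⊠ π' = I_K^F(π_K ⊗ μ)`)

The second half of the file reduces `hDihedral` further, following the printed case (II) ("Suppose
`π'` is of the form `I_K^F(μ)`, for a character `μ` of `C_K`, for some `K`. Then we set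
`π ⊠ π' = I_K^F(π_K ⊗ μ)`, where `π_K` denotes the base change of `π` to `K`. The identity `(L_v)`
at the unramified places `v` is a direct consequence of the identities of Proposition 2.3.1"):

* `satakePolynomial_satakeTensor_eq_inducedSatakePolynomial` — **the unramified projection
  formula** `AI(BC(t_π) ⊗ μ) = t_π ⊗ AI(μ)` (Prop. 2.3.1 (3) with (3.1); Arthur–Clozel Ch. 3,
  (1.1), (6.1)–(6.2)): if `det(X - β) = ∏_{w ∣ v} (X^{f(w|v)} - m_w)` then
  `∏_{a ∈ α, b ∈ β} (X - ab) = ∏_{w ∣ v} ∏_{a ∈ α} (X^{f(w|v)} - m_w a^{f(w|v)})` — proved with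
  `f_w`-th roots `c_w` of `m_w` and the root-of-unity factorisations of
  `BaseChangeInductionAlongProofs` (`prod_range_mul_X_sub_C_eq_pow`,
  `prod_range_mul_satakePolynomial_map_mul`), for any extension `E/K` and any place.
* `exists_inert_satake_ne_of_not_isQuadraticSelfTwistAE` — `¬ IsQuadraticSelfTwistAE K π` supplies
  the hypothesis of `baseChange_cyclic_cuspidal` (an inert place with `-t_{π,v} ≠ t_{π,v}`).
* `Ramakrishnan2000_theoremM.existence_of_isQuadraticSelfTwistAE_right/left` — **Lemma 3.1.1
  (II) when exactly `π'` (resp. `π`) is an a.e. `ε_{K/F}`-self-twist**: `Π = I_K^F(π_K ⊗ μ)` from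
  the named facts `baseChange_cyclic_cuspidal` (Arthur–Clozel Thm. 4.2 (a): `π_K` cuspidal, as
  `π ≇ π ⊗ ε_{K/F}`), `automorphicInduction_cyclic` (Thm. 6.2), the proved twist
  `CuspidalAutomorphicRepData.exists_twist_hecke_hasSatakeParamAt`, and the hypothesis `hLL`.
* `Ramakrishnan2000_theoremM.existence_dihedral_of_leaves` — `hDihedral` from these and the
  remaining doubly-dihedral case `hBoth`; `Ramakrishnan2000_theoremM.of_leaves'` — Theorem M with
  `hDihedral` so replaced.

Two further hypotheses are stated inline there: `hLL` — **Labesse–Langlands at the level of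
Satake polynomials**: a cuspidal `π` on `GL(2)/F` that is an a.e. `ε_{K/F}`-self-twist is
automorphically induced from a Hecke character `μ` of `K`,
`det(X - t_{π,v}) = ∏_{w ∣ v} (X^{f(w|v)} - μ(ϖ_w))` for almost all `v` (op. cit. Prop. 2.3.1 (2):
"The image of `I_{K/F}` consists precisely of those `π ∈ 𝒜(nℓ, F)` such that `π ≃ π ⊗ χ`";
Arthur–Clozel Ch. 3, Thm. 4.2 (b) and Lemma 6.6; the tree has it only in the `L²` model,
`ArthurClozel1989_inducedLift_of_twist_eq`); and `hBoth` — Existence when `π` and `π'` are a.e.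
`ε_{K/F}`-self-twists for the **same** quadratic `K` (op. cit. (II) with `π_K = ν ⊞ ν^θ` not
cuspidal: `I_K^F(π_K ⊗ μ) = I_K^F(νμ) ⊞ I_K^F(ν^θμ)`, which needs isobaric sums of automorphic
inductions of characters, or automorphic induction of non-cuspidal `π_K ⊗ μ` — the tree's
`automorphicInduction_cyclic` is vendored for cuspidal data only).

Nothing in this file assumes `Ramakrishnan2000_theoremM`.

## References

* [Ramakrishnan2000] D. Ramakrishnan, Ann. of Math. (2) 152 (2000), 45–111,
  doi:10.2307/2661379: Theorem M (§3), Lemma 3.1.1 (preprint pp. 13–14), Thm. 2.2.4 (§2.2).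
* [GelbartJacquet1978] S. Gelbart, H. Jacquet, *A relation between automorphic representations of
  `GL(2)` and `GL(3)`*, Ann. Sci. ÉNS 11 (1978), Thm. (9.3).
* [LanglandsCorvallis1979Notion] R. P. Langlands, *On the notion of an automorphic
  representation*, Proc. Sympos. Pure Math. 33 (1979), Part 1, 203–207, Prop. 2.
* [BorelJacquet1979] A. Borel, H. Jacquet, *Automorphic forms and automorphic representations*,
  ibid., 189–202, §4.6, 5.7.
* [JacquetShalikaAJM1981II] H. Jacquet, J. A. Shalika, Amer. J. Math. 103 (1981), 777–815,
  Thm. 4.4 ("[JS2]").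
* [ArthurClozelAMS120] J. Arthur, L. Clozel, *Simple algebras, base change, and the advanced
  theory of the trace formula*, Ann. of Math. Stud. 120 (1989), Ch. 3: (1.1), Thm. 4.2 (a), (b),
  Def. 6.1 with (6.1)–(6.2), Thm. 6.2, Lemma 6.6.
-/

noncomputable section

open scoped MatrixGroups Topology Classical
open NumberField IsDedekindDomain MeasureTheory Filter

namespace Literature.NumberTheory.Automorphic

open AdelicGroupData
open Literature.NumberTheory.GaloisRepresentations (HeckeCharacter)

/-! ### Local algebra: `t_π ⊗ t_{π ⊗ χ} = t_{sym²(π) ⊗ χ} ⊔ t_{ωχ}` -/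

section LocalAlgebra

/-- **The unramified computation of Lemma 3.1.1 (III).** For `t = {a, b}` and `x = χ(ϖ_v)`:
`t ⊗ (x t) = {xa², xab, xab, xb²} = x · Sym²{a, b} + {x ab}` — the Satake parameter of
`π_v ⊗ (π ⊗ χ)_v` is that of `((sym²(π) ⊗ χ) ⊞ ωχ)_v`, `ω(ϖ_v) = ab`.
[cite: Ramakrishnan2000, Lemma 3.1.1 (III)] -/
theorem satakeTensor_pair_twist (a b x : ℂ) :
    satakeTensor ({a, b} : Multiset ℂ) (({a, b} : Multiset ℂ).map (x * ·)) =
      (symmSqParams {a, b}).map (x * ·) + {x * ({a, b} : Multiset ℂ).prod} := by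
  have hm : (({a, b} : Multiset ℂ).map (x * ·)) = {x * a, x * b} := by
    simp only [Multiset.insert_eq_cons, Multiset.map_cons, Multiset.map_singleton]
  rw [hm, satakeTensor_pair_pair, symmSqParams_pair, Multiset.prod_pair]
  have e1 : a * (x * a) = x * (a * a) := by ring
  have e2 : a * (x * b) = x * (a * b) := by ring
  have e3 : b * (x * a) = x * (a * b) := by ring
  have e4 : b * (x * b) = x * (b * b) := by ring
  simp only [Multiset.insert_eq_cons, Multiset.map_cons, Multiset.map_singleton, Multiset.cons_add,
    Multiset.singleton_add, e1, e2, e3, e4]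
  -- `{xab, xbb} = {xbb, xab}` in the tail
  show x * (a * a) ::ₘ x * (a * b) ::ₘ x * (a * b) ::ₘ {x * (b * b)} =
    x * (a * a) ::ₘ x * (a * b) ::ₘ x * (b * b) ::ₘ {x * (a * b)}
  congr 2
  exact Multiset.cons_swap (x * (a * b)) (x * (b * b)) 0

end LocalAlgebra

/-! ### The isobaric-sum hypothesis: binary form -/

section Isobaric

/-- For `n = 1` every automorphic representation datum is cuspidal (the cusp conditions are
empty; Borel–Jacquet 1979, 4.4; local copy of the private lemma of `RamakrishnanCuspidalityOnlyIf`).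
[cite: BorelJacquetCorvallis1979, §4.4] -/
private theorem W_le_cuspFormsGL_one₅ {K : Type} [Field K] [NumberField K]
    {h : isCompact_glFiniteIntegralLevel 1 K} (τ : AutomorphicRepData (AutomorphyDatum.gl 1 K h)) :
    τ.W ≤ cuspFormsGL 1 K h := by
  have e : cuspFormsGL 1 K h = automorphicForms (AutomorphyDatum.gl 1 K h) := by
    unfold cuspFormsGL automorphicForms; congr 1; ext φ
    simp only [Set.mem_setOf_eq, IsCuspFormGL, and_iff_left_iff_imp]
    intro _ k hk hk1
    exact absurd hk1 (by omega)
  rw [e]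
  exact τ.stable.le_automorphicForms

/-- **Binary isobaric sums from the `Fin k`-family form.** If isobaric sums of finite families of
cuspidal Borel–Jacquet data exist at the level of Satake parameters (the hypothesis `hIso`,
Ramakrishnan 2000 Thm. 2.2.4 / Langlands 1979 Prop. 2, module docstring), then for cuspidal `σ₁`
on `GL_{n₁}` and `σ₂` on `GL_{n₂}`, `n₁ + n₂ = n`, some automorphic `Π` on `GL_n(𝔸_F)` has
`t_{Π,v} = t_{σ₁,v} + t_{σ₂,v}` for almost all `v` (the family `(σ₁, σ₂)` indexed by `Fin 2`).
[cite: Ramakrishnan2000, Thm. 2.2.4] [cite: LanglandsCorvallis1979Notion, Prop. 2] -/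
theorem exists_isobaricPair_of_isobaricSum
    (hIso : ∀ (F : Type) [Field F] [NumberField F]
      (hF : ∀ m : ℕ, isCompact_glFiniteIntegralLevel m F) (n k : ℕ) (m : Fin k → ℕ)
      (σ : ∀ i : Fin k, CuspidalAutomorphicRepData (m i) F (hF (m i))), ∑ i, m i = n →
      ∃ P : AutomorphicRepData (AutomorphyDatum.gl n F (hF n)),
        ∀ᶠ v : HeightOneSpectrum (𝓞 F) in cofinite, ∀ β : Fin k → Multiset ℂ,
          (∀ i, (σ i).1.HasSatakeParamAt v (β i)) → P.HasSatakeParamAt v (∑ i, β i))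
    {F : Type} [Field F] [NumberField F] (hF : ∀ m : ℕ, isCompact_glFiniteIntegralLevel m F)
    {n₁ n₂ n : ℕ} (hn : n₁ + n₂ = n) (σ₁ : CuspidalAutomorphicRepData n₁ F (hF n₁))
    (σ₂ : CuspidalAutomorphicRepData n₂ F (hF n₂)) :
    ∃ P : AutomorphicRepData (AutomorphyDatum.gl n F (hF n)),
      ∀ᶠ v : HeightOneSpectrum (𝓞 F) in cofinite, ∀ β₁ β₂ : Multiset ℂ,
        σ₁.1.HasSatakeParamAt v β₁ → σ₂.1.HasSatakeParamAt v β₂ →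
          P.HasSatakeParamAt v (β₁ + β₂) := by
  have hsum : ∑ i, (![n₁, n₂] : Fin 2 → ℕ) i = n := by
    rw [Fin.sum_univ_two]
    simpa using hn
  obtain ⟨P, hP⟩ := hIso F hF n 2 ![n₁, n₂] (Fin.cons σ₁ (Fin.cons σ₂ finZeroElim)) hsum
  refine ⟨P, ?_⟩
  filter_upwards [hP] with v hv β₁ β₂ h₁ h₂
  -- the family `(β₁, β₂)`; the two membership facts are `h₁`, `h₂` up to unfolding `Fin.cons`
  have h := hv ![β₁, β₂] (fun i => by
    refine Fin.cases ?_ (fun j => ?_) i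
    · exact h₁
    · refine Fin.cases ?_ (fun k => k.elim0) j
      exact h₂)
  rw [Fin.sum_univ_two] at h
  simpa using h

end Isobaric

/-! ### Lemma 3.1.1 (III): `π ⊠ (π ⊗ χ) = (sym²(π) ⊗ χ) ⊞ ωχ` -/

section CaseIII

/-- **Ramakrishnan 2000, Lemma 3.1.1 (III) — Existence of `π ⊠ π'` for a twist-equivalent pair
with `π` non-dihedral.** Let `π, π'` be cuspidal on `GL(2)/F` (Borel–Jacquet data, arbitrary
central characters) with `π' ≃ π ⊗ χ` on Satake parameters a.e. (`IsSatakeTwistBy π π' χ`), and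
suppose `π` is for no quadratic `K/F` an a.e. self-twist by `ε_{K/F}` (`¬ IsQuadraticSelfTwistAE`).
Granting: the cuspidal symmetric square lift (`GelbartJacquet_symmSq_cuspidal`, Gelbart–Jacquet
1978 Thm. (9.3): `sym²(π)` cuspidal on `GL(3)/F` with `t = Sym²(t_π)` a.e.), isobaric sums of
cuspidal data (`hIso`, op. cit. Thm. 2.2.4 / Langlands 1979 Prop. 2, module docstring) and the
Borel–Jacquet dictionary (for the Satake shadow `Ω` of the central character `ω_π`,
`exists_heckeCharacter_prod_satake_of_sSup_irreducible`), there is an automorphic `Π` on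
`GL(4)/F` with `t_{Π,v} = t_{π,v} ⊗ t_{π',v}` for almost all `v` — namely
`Π = (sym²(π) ⊗ χ) ⊞ (χω)` (op. cit.: "we set `π ⊠ π' = (sym²(π) ⊗ χ) ⊞ ωχ`, where `ω` is the
central character of `π`"): at a good place, `t_π = {a, b}`, `t_{π'} = χ(ϖ){a, b}` and
`{a, b} ⊗ χ(ϖ){a, b} = χ(ϖ) Sym²{a, b} + {χ(ϖ) ab}` (`satakeTensor_pair_twist`).
[cite: Ramakrishnan2000, Lemma 3.1.1 (III) and Thm. 2.2.4] [cite: GelbartJacquet1978, Thm. (9.3)] -/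
theorem Ramakrishnan2000_theoremM.existence_of_isSatakeTwistBy
    (hGJ : GelbartJacquet_symmSq_cuspidal)
    (hIso : ∀ (F : Type) [Field F] [NumberField F]
      (hF : ∀ m : ℕ, isCompact_glFiniteIntegralLevel m F) (n k : ℕ) (m : Fin k → ℕ)
      (σ : ∀ i : Fin k, CuspidalAutomorphicRepData (m i) F (hF (m i))), ∑ i, m i = n →
      ∃ P : AutomorphicRepData (AutomorphyDatum.gl n F (hF n)),
        ∀ᶠ v : HeightOneSpectrum (𝓞 F) in cofinite, ∀ β : Fin k → Multiset ℂ,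
          (∀ i, (σ i).1.HasSatakeParamAt v (β i)) → P.HasSatakeParamAt v (∑ i, β i))
    (hA : ∀ {n : ℕ} {K : Type} [Field K] [NumberField K] (hK : isCompact_glFiniteIntegralLevel n K)
      (μ : Measure (gl n K).automorphicQuotient) [(gl n K).IsAutomorphicMeasure μ],
      AutomorphicRepsGL.exists_isAssociatedL2 hK μ)
    (hL2 : ∀ {n : ℕ} {K : Type} [Field K] [NumberField K] (hK : isCompact_glFiniteIntegralLevel n K)
      (μ : Measure (gl n K).automorphicQuotient) [(gl n K).IsAutomorphicMeasure μ],
      hasSatakeParamAt_iff_L2 hK μ)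
    (hss : ∀ {n : ℕ} {K : Type} [Field K] [NumberField K] (hK : isCompact_glFiniteIntegralLevel n K),
      AutomorphicRepsGL.stable_cuspidal_eq_sSup_irreducible hK)
    (F : Type) [Field F] [NumberField F]
    (h2 : isCompact_glFiniteIntegralLevel 2 F) (h4 : isCompact_glFiniteIntegralLevel 4 F)
    (π π' : CuspidalAutomorphicRepData 2 F h2)
    (hπ : ∀ (K : Type) [Field K] [NumberField K] [Algebra F K], Module.finrank F K = 2 →
      ¬ IsQuadraticSelfTwistAE K π.1)
    (χ : HeckeCharacter F) (hχ : IsSatakeTwistBy π.1 π'.1 χ) :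
    ∃ P : AutomorphicRepData (AutomorphyDatum.gl 4 F h4),
      ∀ᶠ v : HeightOneSpectrum (𝓞 F) in cofinite, ∀ α β : Multiset ℂ,
        π.1.HasSatakeParamAt v α → π'.1.HasSatakeParamAt v β →
          P.HasSatakeParamAt v (satakeTensor α β) := by
  haveI : NeZero (2 : ℕ) := ⟨by norm_num⟩
  haveI : NeZero (3 : ℕ) := ⟨by norm_num⟩
  have hF : ∀ m : ℕ, isCompact_glFiniteIntegralLevel m F := fun m =>
    isCompact_glFiniteIntegralLevel_holds m F
  -- `sym²(π)`, cuspidal on `GL(3)` (Gelbart–Jacquet), and its twist `sym²(π) ⊗ χ`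
  obtain ⟨S, hS⟩ := hGJ F h2 (hF 3) π hπ
  obtain ⟨S', hS'⟩ := CuspidalAutomorphicRepData.exists_twist_hecke_hasSatakeParamAt χ S
  -- `Ω(ϖ_v) = ∏ t_{π,v}`: the Satake shadow of the central character `ω` of `π`
  obtain ⟨μ, hμ⟩ := AdelicGroupData.exists_isAutomorphicMeasure_gl_holds 2 F
  haveI := hμ
  obtain ⟨Ω, hΩ⟩ :=
    exists_heckeCharacter_prod_satake_of_sSup_irreducible (hA h2 μ) (hL2 h2 μ) (hss h2) π
  -- the representation `χω` of `GL(1)/F`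
  obtain ⟨τ, hτ⟩ :=
    exists_automorphicRepData_hasSatakeParamAt_valueAtUniformizer (hF 1) (χ * Ω)
  set τc : CuspidalAutomorphicRepData 1 F (hF 1) := ⟨τ, W_le_cuspFormsGL_one₅ τ⟩ with hτc
  -- the isobaric sum `(sym²(π) ⊗ χ) ⊞ χω` on `GL(3 + 1)`
  obtain ⟨P, hP⟩ :=
    exists_isobaricPair_of_isobaricSum hIso hF (show 3 + 1 = 4 by norm_num) S' τc
  refine ⟨P, ?_⟩
  rw [isSatakeTwistBy_iff] at hχ
  filter_upwards [hS, hS', hΩ, hτ, hP, hχ] with v hSv hS'v hΩv hτv hPv hχv α β hα hβ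
  -- `β = χ(ϖ_v) α`, `α = {a, b}`
  have hβeq : β = α.map (χ.valueAtUniformizer v * ·) :=
    AutomorphicRepData.hasSatakeParamAt_unique_holds π'.1 hβ (hχv α hα)
  obtain ⟨a, b, rfl⟩ := Multiset.card_eq_two.mp hα.card_eq
  have h₁ : S'.1.HasSatakeParamAt v ((symmSqParams {a, b}).map (χ.valueAtUniformizer v * ·)) :=
    hS'v _ (hSv _ hα)
  have h₂ : τc.1.HasSatakeParamAt v {(χ * Ω).valueAtUniformizer v} := hτv
  have h := hPv _ _ h₁ h₂
  rw [HeckeCharacter.valueAtUniformizer_mul, hΩv _ hα] at h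
  rw [hβeq, satakeTensor_pair_twist]
  exact h

end CaseIII

/-! ### (R1) by the case distinction of Lemma 3.1.1, and Theorem M from the leaves -/

section Assembly

/-- **Ramakrishnan 2000, Theorem M, Existence clause for cuspidal pairs — by the cases of Lemma
3.1.1.** For cuspidal `π, π'` on `GL(2)/F` there is an automorphic `Π` on `GL(4)/F` with
`t_{Π,v} = t_{π,v} ⊗ t_{π',v}` for almost all `v`, granting: the cuspidal (general-type) case
`Ramakrishnan2000_boxTimes_cuspidal`; case (II) of Lemma 3.1.1 as the hypothesis `hDihedral` (some
quadratic `K/F` makes `π` or `π'` an a.e. `ε_{K/F}`-self-twist — "`π ⊠ π' = I_K^F(π_K ⊗ μ)`");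
and, for case (III) (`π' ≃ π ⊗ χ`, `π` non-dihedral), `GelbartJacquet_symmSq_cuspidal`, isobaric
sums (`hIso`) and the Borel–Jacquet dictionary (`existence_of_isSatakeTwistBy`). The case
distinction: some quadratic `K` with `IsQuadraticSelfTwistAE K π ∨ IsQuadraticSelfTwistAE K π'`
(→ (II)); else `∃ χ, IsSatakeTwistBy π π' χ` (→ (III)); else general type (→ the cuspidal fact,
whose hypotheses are exactly these two negations).
[cite: Ramakrishnan2000, Theorem M (§3) and Lemma 3.1.1] -/
theorem Ramakrishnan2000_theoremM.existence_of_leaves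
    (hX : Ramakrishnan2000_boxTimes_cuspidal)
    (hGJ : GelbartJacquet_symmSq_cuspidal)
    (hIso : ∀ (F : Type) [Field F] [NumberField F]
      (hF : ∀ m : ℕ, isCompact_glFiniteIntegralLevel m F) (n k : ℕ) (m : Fin k → ℕ)
      (σ : ∀ i : Fin k, CuspidalAutomorphicRepData (m i) F (hF (m i))), ∑ i, m i = n →
      ∃ P : AutomorphicRepData (AutomorphyDatum.gl n F (hF n)),
        ∀ᶠ v : HeightOneSpectrum (𝓞 F) in cofinite, ∀ β : Fin k → Multiset ℂ,
          (∀ i, (σ i).1.HasSatakeParamAt v (β i)) → P.HasSatakeParamAt v (∑ i, β i))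
    (hA : ∀ {n : ℕ} {K : Type} [Field K] [NumberField K] (hK : isCompact_glFiniteIntegralLevel n K)
      (μ : Measure (gl n K).automorphicQuotient) [(gl n K).IsAutomorphicMeasure μ],
      AutomorphicRepsGL.exists_isAssociatedL2 hK μ)
    (hL2 : ∀ {n : ℕ} {K : Type} [Field K] [NumberField K] (hK : isCompact_glFiniteIntegralLevel n K)
      (μ : Measure (gl n K).automorphicQuotient) [(gl n K).IsAutomorphicMeasure μ],
      hasSatakeParamAt_iff_L2 hK μ)
    (hss : ∀ {n : ℕ} {K : Type} [Field K] [NumberField K] (hK : isCompact_glFiniteIntegralLevel n K),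
      AutomorphicRepsGL.stable_cuspidal_eq_sSup_irreducible hK)
    (hDihedral : ∀ (F : Type) [Field F] [NumberField F]
      (h2 : isCompact_glFiniteIntegralLevel 2 F) (h4 : isCompact_glFiniteIntegralLevel 4 F)
      (π π' : CuspidalAutomorphicRepData 2 F h2)
      (K : Type) [Field K] [NumberField K] [Algebra F K], Module.finrank F K = 2 →
      (IsQuadraticSelfTwistAE K π.1 ∨ IsQuadraticSelfTwistAE K π'.1) →
      ∃ P : AutomorphicRepData (AutomorphyDatum.gl 4 F h4),
        ∀ᶠ v : HeightOneSpectrum (𝓞 F) in cofinite, ∀ α β : Multiset ℂ,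
          π.1.HasSatakeParamAt v α → π'.1.HasSatakeParamAt v β →
            P.HasSatakeParamAt v (satakeTensor α β))
    (F : Type) [Field F] [NumberField F]
    (h2 : isCompact_glFiniteIntegralLevel 2 F) (h4 : isCompact_glFiniteIntegralLevel 4 F)
    (π π' : CuspidalAutomorphicRepData 2 F h2) :
    ∃ P : AutomorphicRepData (AutomorphyDatum.gl 4 F h4),
      ∀ᶠ v : HeightOneSpectrum (𝓞 F) in cofinite, ∀ α β : Multiset ℂ,
        π.1.HasSatakeParamAt v α → π'.1.HasSatakeParamAt v β →
          P.HasSatakeParamAt v (satakeTensor α β) := by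
  by_cases hd : ∃ (K : Type) (_ : Field K) (_ : NumberField K) (_ : Algebra F K),
      Module.finrank F K = 2 ∧ (IsQuadraticSelfTwistAE K π.1 ∨ IsQuadraticSelfTwistAE K π'.1)
  · -- case (II): a dihedral member
    obtain ⟨K, _, _, _, hK, hor⟩ := hd
    exact hDihedral F h2 h4 π π' K hK hor
  · -- neither `π` nor `π'` is an a.e. `ε_{K/F}`-self-twist, for any quadratic `K`
    have hnd : ∀ (K : Type) [Field K] [NumberField K] [Algebra F K], Module.finrank F K = 2 →
        ¬ IsQuadraticSelfTwistAE K π.1 ∧ ¬ IsQuadraticSelfTwistAE K π'.1 := by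
      intro K _ _ _ hK
      exact not_or.1 fun hor => hd ⟨K, inferInstance, inferInstance, inferInstance, hK, hor⟩
    by_cases ht : ∃ χ : HeckeCharacter F, IsSatakeTwistBy π.1 π'.1 χ
    · -- case (III): `π' ≃ π ⊗ χ`
      obtain ⟨χ, hχ⟩ := ht
      exact Ramakrishnan2000_theoremM.existence_of_isSatakeTwistBy hGJ hIso hA hL2 hss F h2 h4
        π π' (fun K _ _ _ hK => (hnd K hK).1) χ hχ
    · -- general type: the cuspidal `π ⊠ π'` of `Ramakrishnan2000_boxTimes_cuspidal`
      obtain ⟨P, hP⟩ := hX F h2 h4 π π' (fun K _ _ _ hK => hnd K hK)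
        (fun χ hχ => ht ⟨χ, isSatakeTwistBy_of_eventually_eq_map hχ⟩)
      exact ⟨P.1, hP⟩

/-- **`Ramakrishnan2000_theoremM` from the leaves.** Theorem M follows from: the cuspidal-case fact
`Ramakrishnan2000_boxTimes_cuspidal` (Theorem M for pairs of general type, op. cit. §§3.3–3.7);
the cuspidal symmetric square lift `GelbartJacquet_symmSq_cuspidal` and isobaric sums of cuspidal
data (`hIso`, Thm. 2.2.4) for Lemma 3.1.1 (III); Lemma 3.1.1 (II) (`hDihedral`); and — for the
"only if" half of the cuspidality criterion (`Ramakrishnan2000_theoremM.onlyIf_of_leaves`) and the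
central characters — Jacquet–Shalika (2.2), (2.3) for Borel–Jacquet data
(`JacquetShalika1981_partialPairL_boundary_repData`, `…_pole_repData`) and the Borel–Jacquet
dictionary (`exists_isAssociatedL2`, `hasSatakeParamAt_iff_L2`, `stable_cuspidal_eq_sSup_irreducible`).
This is `Ramakrishnan2000_theoremM.of_boxTimes_cuspidal_of_leaves` with its Existence hypothesis
(R1) discharged by `Ramakrishnan2000_theoremM.existence_of_leaves`.
[cite: Ramakrishnan2000, Theorem M (§3), Lemma 3.1.1, Thm. 2.2.4 and Prop. 3.2.1] -/
theorem Ramakrishnan2000_theoremM.of_leaves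
    (hX : Ramakrishnan2000_boxTimes_cuspidal)
    (hGJ : GelbartJacquet_symmSq_cuspidal)
    (hIso : ∀ (F : Type) [Field F] [NumberField F]
      (hF : ∀ m : ℕ, isCompact_glFiniteIntegralLevel m F) (n k : ℕ) (m : Fin k → ℕ)
      (σ : ∀ i : Fin k, CuspidalAutomorphicRepData (m i) F (hF (m i))), ∑ i, m i = n →
      ∃ P : AutomorphicRepData (AutomorphyDatum.gl n F (hF n)),
        ∀ᶠ v : HeightOneSpectrum (𝓞 F) in cofinite, ∀ β : Fin k → Multiset ℂ,
          (∀ i, (σ i).1.HasSatakeParamAt v (β i)) → P.HasSatakeParamAt v (∑ i, β i))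
    (hDihedral : ∀ (F : Type) [Field F] [NumberField F]
      (h2 : isCompact_glFiniteIntegralLevel 2 F) (h4 : isCompact_glFiniteIntegralLevel 4 F)
      (π π' : CuspidalAutomorphicRepData 2 F h2)
      (K : Type) [Field K] [NumberField K] [Algebra F K], Module.finrank F K = 2 →
      (IsQuadraticSelfTwistAE K π.1 ∨ IsQuadraticSelfTwistAE K π'.1) →
      ∃ P : AutomorphicRepData (AutomorphyDatum.gl 4 F h4),
        ∀ᶠ v : HeightOneSpectrum (𝓞 F) in cofinite, ∀ α β : Multiset ℂ,
          π.1.HasSatakeParamAt v α → π'.1.HasSatakeParamAt v β →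
            P.HasSatakeParamAt v (satakeTensor α β))
    (h22 : JacquetShalika1981_partialPairL_boundary_repData)
    (h23 : JacquetShalika1981_partialPairL_pole_repData)
    (hA : ∀ {n : ℕ} {K : Type} [Field K] [NumberField K] (hK : isCompact_glFiniteIntegralLevel n K)
      (μ : Measure (gl n K).automorphicQuotient) [(gl n K).IsAutomorphicMeasure μ],
      AutomorphicRepsGL.exists_isAssociatedL2 hK μ)
    (hL2 : ∀ {n : ℕ} {K : Type} [Field K] [NumberField K] (hK : isCompact_glFiniteIntegralLevel n K)
      (μ : Measure (gl n K).automorphicQuotient) [(gl n K).IsAutomorphicMeasure μ],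
      hasSatakeParamAt_iff_L2 hK μ)
    (hss : ∀ {n : ℕ} {K : Type} [Field K] [NumberField K] (hK : isCompact_glFiniteIntegralLevel n K),
      AutomorphicRepsGL.stable_cuspidal_eq_sSup_irreducible hK) :
    Ramakrishnan2000_theoremM :=
  Ramakrishnan2000_theoremM.of_boxTimes_cuspidal_of_leaves hX
    (fun F _ _ h2 h4 π π' =>
      Ramakrishnan2000_theoremM.existence_of_leaves hX hGJ hIso hA hL2 hss hDihedral F h2 h4 π π')
    h22 h23 hA hL2 hss

end Assembly

/-! ### Algebra of induced Satake polynomials: `AI(BC(t) ⊗ s) = t ⊗ AI(s)` -/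

section InducedAlgebra

open scoped Polynomial
open Polynomial

variable {K : Type} [Field K] [NumberField K] {E : Type} [Field E] [NumberField E] [Algebra K E]

/-- `α ⊗ (∑ᵢ βᵢ) = ∑ᵢ α ⊗ βᵢ` (additivity of `satakeTensor` in the second variable — the
tree's `satakeTensor_add_right` / `satakeTensor_zero_right` of `PairLFunctionPolesRankNeLandau` /
`RamakrishnanMultiplicityOneLemma414`, re-derived inline to keep the imports of this file small).
[folklore] -/
theorem satakeTensor_finset_sum_right {ι : Type*} (s : Finset ι) (α : Multiset ℂ)
    (β : ι → Multiset ℂ) :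
    satakeTensor α (∑ i ∈ s, β i) = ∑ i ∈ s, satakeTensor α (β i) := by
  have hzero : satakeTensor α 0 = 0 := by
    induction α using Multiset.induction_on with
    | empty => simp
    | cons a α ih => simp [ih]
  have hadd : ∀ β β' : Multiset ℂ,
      satakeTensor α (β + β') = satakeTensor α β + satakeTensor α β' := fun β β' => by
    clear hzero
    induction α using Multiset.induction_on with
    | empty => simp
    | cons a α ih =>
      simp only [satakeTensor_cons_left, Multiset.map_add, ih]
      abel
  induction s using Finset.cons_induction with
  | empty => simp [hzero]
  | cons i s hi ih => rw [Finset.sum_cons, Finset.sum_cons, hadd, ih]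

/-- `P_{t ⊗ α} = ∏_{r ∈ t} P_{r α}`. [folklore] -/
theorem satakePolynomial_satakeTensor_eq_prod_map (t α : Multiset ℂ) :
    satakePolynomial (satakeTensor t α) =
      (t.map fun r => satakePolynomial (α.map (r * ·))).prod := by
  induction t using Multiset.induction_on with
  | empty => simp [satakePolynomial_zero]
  | cons r t ih =>
    rw [satakeTensor_cons_left, satakePolynomial_add, ih, Multiset.map_cons, Multiset.prod_cons]

/-- **The local projection formula `AI(BC(t_π) ⊗ μ) = t_π ⊗ AI(μ)` at an unramified place**
(the unramified content of Ramakrishnan 2000, Prop. 2.3.1 (3) "`L(s, π × I(β)) = L(s, π_K × β)`"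
with (3.1), for `β = μ` a character; Arthur–Clozel 1989, Ch. 3, (1.1) and (6.1)–(6.2)). Let `v`
be a place of `K`, `m_w ∈ ℂ` for the places `w ∣ v` of `E` (the values `μ(ϖ_w)`), `α` a
multiset (`t_{π,v}`) and `β` a multiset whose Satake polynomial is the induced polynomial
`∏_{w ∣ v} (X^{f(w|v)} - m_w)` (`t_{I(μ),v}`). Then the Satake polynomial of `α ⊗ β` is the
induced polynomial of the family `w ↦ m_w · α^{f(w|v)}` (the Satake parameters of
`π_K ⊗ μ` at `w`): `∏_{a ∈ α, b ∈ β} (X - ab) = ∏_{w ∣ v} ∏_{a ∈ α} (X^{f(w|v)} - m_w a^{f(w|v)})`.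
Proof: with `c_w^{f_w} = m_w` and `ζ_w` a primitive `f_w`-th root of unity,
`β = ⊎_w {ζ_w^i c_w : i < f_w}` and `∏_{i < f} P_{ζ^i c α}(X) = P_{(cα)^f}(X^f)`
(`prod_range_mul_satakePolynomial_map_mul`).
[cite: Ramakrishnan2000, Prop. 2.3.1 (3) with (3.1)] [cite: ArthurClozelAMS120, Ch. 3, (1.1) and (6.1)–(6.2)] -/
theorem satakePolynomial_satakeTensor_eq_inducedSatakePolynomial (v : HeightOneSpectrum (𝓞 K))
    (m : HeightOneSpectrum (𝓞 E) → ℂ) (α β : Multiset ℂ)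
    (hf : ∀ w : HeightOneSpectrum (𝓞 E), w.asIdeal.under (𝓞 K) = v.asIdeal →
      0 < w.asIdeal.inertiaDeg (𝓞 K))
    (hβ : satakePolynomial β = inducedSatakePolynomial v (fun w => {m w})) :
    satakePolynomial (satakeTensor α β) =
      inducedSatakePolynomial v
        (fun w => (α.map (· ^ w.asIdeal.inertiaDeg (𝓞 K))).map (m w * ·)) := by
  have hS := finite_setOf_asIdeal_under_eq (E := E) v
  -- `f_w`-th roots `c_w` of `m_w` and primitive `f_w`-th roots of unity `ζ_w`, for `w ∣ v`
  have hc : ∀ w ∈ hS.toFinset, ∃ c : ℂ, c ^ w.asIdeal.inertiaDeg (𝓞 K) = m w := fun w hw =>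
    IsAlgClosed.exists_pow_nat_eq (m w) (hf w (hS.mem_toFinset.1 hw))
  choose! c hcw using hc
  have hζ : ∀ w ∈ hS.toFinset, ∃ ζ : ℂ, IsPrimitiveRoot ζ (w.asIdeal.inertiaDeg (𝓞 K)) :=
    fun w hw => ⟨_, Complex.isPrimitiveRoot_exp _ (hf w (hS.mem_toFinset.1 hw)).ne'⟩
  choose! ζ hζw using hζ
  -- the root multisets `ρ_w = {ζ_w^i c_w : i < f_w}`
  obtain ⟨ρ, hρ⟩ : ∃ ρ : HeightOneSpectrum (𝓞 E) → Multiset ℂ, ∀ w,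
      ρ w = (Multiset.range (w.asIdeal.inertiaDeg (𝓞 K))).map fun i => ζ w ^ i * c w :=
    ⟨_, fun _ => rfl⟩
  have hρP : ∀ w ∈ hS.toFinset,
      satakePolynomial (ρ w) = X ^ w.asIdeal.inertiaDeg (𝓞 K) - C (m w) := by
    intro w hw
    have h := prod_range_mul_X_sub_C_eq_pow (hf w (hS.mem_toFinset.1 hw)) (hζw w hw) (c w) 1
    rw [one_mul, pow_one, hcw w hw] at h
    rw [← h, hρ, satakePolynomial, Finset.prod_eq_multiset_prod, Finset.range_val,
      Multiset.map_map]
    rfl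
  -- (i) `β = ⊎_{w ∣ v} ρ_w`
  have hβ' : β = ∑ w ∈ hS.toFinset, ρ w := by
    have h1 : inducedSatakePolynomial v (fun w => ({m w} : Multiset ℂ)) =
        ∏ w ∈ hS.toFinset, (X ^ w.asIdeal.inertiaDeg (𝓞 K) - C (m w)) := by
      rw [inducedSatakePolynomial, finprod_mem_eq_finite_toFinset_prod _ hS]
      refine Finset.prod_congr rfl fun w _ => ?_
      rw [satakePolynomial_comp_X_pow, Multiset.map_singleton, Multiset.prod_singleton]
    have h2 : satakePolynomial (∑ w ∈ hS.toFinset, ρ w) =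
        ∏ w ∈ hS.toFinset, (X ^ w.asIdeal.inertiaDeg (𝓞 K) - C (m w)) := by
      rw [satakePolynomial_sum]
      exact Finset.prod_congr rfl hρP
    rw [← roots_satakePolynomial β, hβ, h1, ← h2, roots_satakePolynomial]
  -- (ii) the identity above one `w ∣ v`
  have hw1 : ∀ w ∈ hS.toFinset, satakePolynomial (satakeTensor α (ρ w)) =
      (satakePolynomial ((α.map (· ^ w.asIdeal.inertiaDeg (𝓞 K))).map (m w * ·))).comp
        (X ^ w.asIdeal.inertiaDeg (𝓞 K)) := by
    intro w hw
    have hfw := hf w (hS.mem_toFinset.1 hw)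
    rw [satakeTensor_comm, satakePolynomial_satakeTensor_eq_prod_map]
    have h := prod_range_mul_satakePolynomial_map_mul hfw (hζw w hw) (α.map (c w * ·)) 1
    rw [one_mul, pow_one] at h
    have e1 : (α.map (c w * ·)).map (· ^ w.asIdeal.inertiaDeg (𝓞 K)) =
        (α.map (· ^ w.asIdeal.inertiaDeg (𝓞 K))).map (m w * ·) := by
      simp only [Multiset.map_map, Function.comp_def, mul_pow, hcw w hw]
    have e2 : ∀ i : ℕ, (α.map (c w * ·)).map (ζ w ^ i * ·) = α.map (ζ w ^ i * c w * ·) :=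
      fun i => by simp only [Multiset.map_map, Function.comp_def, mul_assoc]
    rw [e1] at h
    simp_rw [e2] at h
    rw [← h, hρ, Finset.prod_eq_multiset_prod, Finset.range_val, Multiset.map_map]
    rfl
  -- assemble over the places above `v`
  rw [hβ', satakeTensor_finset_sum_right, satakePolynomial_sum, inducedSatakePolynomial,
    finprod_mem_eq_finite_toFinset_prod _ hS]
  exact Finset.prod_congr rfl hw1

end InducedAlgebra

/-! ### Lemma 3.1.1 (II), one dihedral member: `π ⊠ π' = I_K^F(π_K ⊗ μ)` -/

section CaseII

open scoped Polynomial
open Polynomial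

/-- **From "not an a.e. `ε_{K/F}`-self-twist" to the hypothesis of cuspidal quadratic base
change.** If `[K : F] = 2` and the cuspidal `π` on `GL(n)/F` is *not* an a.e. self-twist by
`ε_{K/F}` (`¬ IsQuadraticSelfTwistAE K π`), then at some place `v` of `F`, inert in `K` (a place
`w ∣ v` of residue degree `2 = [K : F]`), some Satake parameter `α` of `π` satisfies `ζ α ≠ α` for
every primitive square root of unity `ζ` (i.e. `-α ≠ α`) — the hypothesis of
`baseChange_cyclic_cuspidal` ("`π ≇ π ⊗ η`" at the level of one inert place). Indeed
`ε_{K/F}(v) α ≠ α` forces `ε_{K/F}(v) = -1`, i.e. no place above `v` has residue degree `1`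
(`quadraticSign`), so every `w ∣ v` has residue degree `2`
(`inertiaDeg_eq_one_or_two_of_finrank_eq_two`). [cite: ArthurClozelAMS120, Ch. 3, Thm. 4.2 (a) and proof of Thm. 3.1] -/
theorem exists_inert_satake_ne_of_not_isQuadraticSelfTwistAE {F : Type} [Field F] [NumberField F]
    {K : Type} [Field K] [NumberField K] [Algebra F K] (hK : Module.finrank F K = 2) {n : ℕ}
    {hF : isCompact_glFiniteIntegralLevel n F}
    {π : AutomorphicRepData (AutomorphyDatum.gl n F hF)}
    (hπ : ¬ ∀ᶠ v : HeightOneSpectrum (𝓞 F) in cofinite, ∀ α : Multiset ℂ,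
      π.HasSatakeParamAt v α → α.map (quadraticSign K v * ·) = α) :
    ∃ (v : HeightOneSpectrum (𝓞 F)) (w : HeightOneSpectrum (𝓞 K)) (α : Multiset ℂ),
      w.asIdeal.under (𝓞 F) = v.asIdeal ∧ w.asIdeal.inertiaDeg (𝓞 F) = Module.finrank F K ∧
      π.HasSatakeParamAt v α ∧
      ∀ ζ : ℂ, IsPrimitiveRoot ζ (Module.finrank F K) → α.map (ζ * ·) ≠ α := by
  obtain ⟨v, hv⟩ := (Filter.not_eventually.1 hπ).exists
  push Not at hv
  obtain ⟨α, hα, hne⟩ := hv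
  -- `ε_{K/F}(v) = -1`
  have hε : quadraticSign K v = -1 := by
    rcases quadraticSign_eq_one_or (E := K) (v := v) with h | h
    · exact absurd (by rw [h]; simp) hne
    · exact h
  have hnot : ¬ ∃ w : HeightOneSpectrum (𝓞 K), w.asIdeal.under (𝓞 F) = v.asIdeal ∧
      w.asIdeal.inertiaDeg (𝓞 F) = 1 := by
    intro h
    have : quadraticSign K v = 1 := by unfold quadraticSign; rw [if_pos h]
    rw [hε] at this
    norm_num at this
  obtain ⟨w, hw⟩ := exists_above (E := K) v
  have hfw : w.asIdeal.inertiaDeg (𝓞 F) = 2 := by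
    rcases inertiaDeg_eq_one_or_two_of_finrank_eq_two hK v w hw with h | h
    · exact absurd ⟨w, hw, h⟩ hnot
    · exact h
  refine ⟨v, w, α, hw, by rw [hfw, hK], hα, fun ζ hζ => ?_⟩
  rw [hK] at hζ
  rw [hζ.eq_neg_one_of_two_right, ← hε]
  exact hne

/-- **Ramakrishnan 2000, Lemma 3.1.1 (II) — Existence of `π ⊠ π'` when `π'` is dihedral with
respect to a quadratic `K/F` and `π` is not.** Let `π, π'` be cuspidal on `GL(2)/F`, `[K : F] = 2`,
with `π'` an a.e. self-twist by `ε_{K/F}` (`IsQuadraticSelfTwistAE K π'`) and `π` not. Granting: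
`hLL` — the characterisation of such `π'` as automorphic inductions of Hecke characters `μ` of
`K` at the level of Satake polynomials, `det(X - t_{π',v}) = ∏_{w ∣ v} (X^{f(w|v)} - μ(ϖ_w))` a.e.
(Ramakrishnan 2000, Prop. 2.3.1 (2): "The image of `I_{K/F}` consists precisely of those `π` …
such that `π ≃ π ⊗ χ`"; Labesse–Langlands; Arthur–Clozel Ch. 3, Thm. 4.2 (b), Lemma 6.6 — in the
tree only in the `L²` model, `ArthurClozel1989_inducedLift_of_twist_eq`, whence the hypothesis);
cuspidal quadratic base change (`baseChange_cyclic_cuspidal`, Arthur–Clozel Thm. 4.2 (a):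
`π_K` cuspidal with `t_{π_K,w} = t_{π,v}^{f(w|v)}`, applicable because `π ≇ π ⊗ ε_{K/F}`,
`exists_inert_satake_ne_of_not_isQuadraticSelfTwistAE`); and cyclic automorphic induction of
cuspidal representations (`automorphicInduction_cyclic`, Arthur–Clozel Thm. 6.2) — there is an
automorphic `Π` on `GL(4)/F` with `t_{Π,v} = t_{π,v} ⊗ t_{π',v}` for almost all `v`, namely
`Π = I_K^F(π_K ⊗ μ)` (op. cit.: "we set `π ⊠ π' = I_K^F(π_K ⊗ μ)` … The identity `(L_v)` at the
unramified places `v` is a direct consequence of the identities of Proposition 2.3.1"): the twist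
`π_K ⊗ μ` is the proved `CuspidalAutomorphicRepData.exists_twist_hecke_hasSatakeParamAt`, and the
unramified identity is `satakePolynomial_satakeTensor_eq_inducedSatakePolynomial`.
[cite: Ramakrishnan2000, Lemma 3.1.1 (II) and Prop. 2.3.1] [cite: ArthurClozelAMS120, Ch. 3, Thm. 4.2 (a) and Thm. 6.2] -/
theorem Ramakrishnan2000_theoremM.existence_of_isQuadraticSelfTwistAE_right
    (hBC : baseChange_cyclic_cuspidal) (hAI : automorphicInduction_cyclic)
    (hLL : ∀ (F K : Type) [Field F] [NumberField F] [Field K] [NumberField K] [Algebra F K],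
      Module.finrank F K = 2 → ∀ (h2 : isCompact_glFiniteIntegralLevel 2 F)
        (π : CuspidalAutomorphicRepData 2 F h2), IsQuadraticSelfTwistAE K π.1 →
        ∃ μ : HeckeCharacter K, ∀ᶠ v : HeightOneSpectrum (𝓞 F) in cofinite, ∀ β : Multiset ℂ,
          π.1.HasSatakeParamAt v β →
            satakePolynomial β = inducedSatakePolynomial v (fun w => {μ.valueAtUniformizer w}))
    (F : Type) [Field F] [NumberField F]
    (h2 : isCompact_glFiniteIntegralLevel 2 F) (h4 : isCompact_glFiniteIntegralLevel 4 F)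
    (π π' : CuspidalAutomorphicRepData 2 F h2)
    (K : Type) [Field K] [NumberField K] [Algebra F K] (hK : Module.finrank F K = 2)
    (hπ : ¬ IsQuadraticSelfTwistAE K π.1) (hπ' : IsQuadraticSelfTwistAE K π'.1) :
    ∃ P : AutomorphicRepData (AutomorphyDatum.gl 4 F h4),
      ∀ᶠ v : HeightOneSpectrum (𝓞 F) in cofinite, ∀ α β : Multiset ℂ,
        π.1.HasSatakeParamAt v α → π'.1.HasSatakeParamAt v β →
          P.HasSatakeParamAt v (satakeTensor α β) := by
  haveI : NeZero (2 : ℕ) := ⟨by norm_num⟩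
  haveI : FiniteDimensional F K := Module.finite_of_finrank_eq_succ hK
  haveI : Algebra.IsQuadraticExtension F K := ⟨hK⟩
  haveI : IsGalois F K := inferInstance
  have hprime : (Module.finrank F K).Prime := by rw [hK]; exact Nat.prime_two
  haveI : IsCyclic (K ≃ₐ[F] K) :=
    isCyclic_of_prime_card (p := Module.finrank F K) (hp := ⟨hprime⟩)
      (IsGalois.card_aut_eq_finrank F K)
  have hK2 : isCompact_glFiniteIntegralLevel 2 K := isCompact_glFiniteIntegralLevel_holds 2 K
  have hF4 : isCompact_glFiniteIntegralLevel (2 * Module.finrank F K) F :=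
    isCompact_glFiniteIntegralLevel_holds _ F
  -- `π' = I_K^F(μ)` on Satake polynomials
  obtain ⟨μ, hμ⟩ := hLL F K hK h2 π' hπ'
  -- the cuspidal base change `π_K` (Thm. 4.2 (a)) and its twist `π_K ⊗ μ`
  obtain ⟨PK, hPK⟩ := hBC 2 F K hprime h2 π
    (exists_inert_satake_ne_of_not_isQuadraticSelfTwistAE hK hπ) hK2
  obtain ⟨PKμ, hPKμ⟩ := CuspidalAutomorphicRepData.exists_twist_hecke_hasSatakeParamAt μ PK
  -- `Π = I_K^F(π_K ⊗ μ)` on `GL(2 · [K:F]) = GL(4)`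
  obtain ⟨P, hP⟩ := exists_isAutomorphicInductionAlong_of_rank_eq
    (show 2 * Module.finrank F K = 4 by rw [hK]) h4 (hAI 2 F K ‹_› two_pos hK2 hF4 PKμ)
  refine ⟨P, ?_⟩
  -- `t_{π_K ⊗ μ, w} = μ(ϖ_w) t_{π,v}^{f(w|v)}` at every `w` above almost every `v`
  have hup : ∀ᶠ w : HeightOneSpectrum (𝓞 K) in cofinite, ∀ (v : HeightOneSpectrum (𝓞 F))
      (α : Multiset ℂ), w.asIdeal.under (𝓞 F) = v.asIdeal → π.1.HasSatakeParamAt v α →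
        PKμ.1.HasSatakeParamAt w
          ((α.map (· ^ w.asIdeal.inertiaDeg (𝓞 F))).map (μ.valueAtUniformizer w * ·)) := by
    filter_upwards [hPK, hPKμ] with w hw hwμ v α hv hα
    exact hwμ _ (hw v α hv hα)
  have hup' := eventually_forall_under_eq (F := F) (E := K) hup
  -- residue degrees above every `v` are positive
  have hf : ∀ (v : HeightOneSpectrum (𝓞 F)) (w : HeightOneSpectrum (𝓞 K)),
      w.asIdeal.under (𝓞 F) = v.asIdeal → 0 < w.asIdeal.inertiaDeg (𝓞 F) := fun v w hw => by
    rcases inertiaDeg_eq_one_or_two_of_finrank_eq_two hK v w hw with h | h <;> omega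
  filter_upwards [hP, hup', hμ] with v hPv hupv hμv α β hα hβ
  obtain ⟨δ, hδ, hδpol⟩ := hPv
    (fun w => (α.map (· ^ w.asIdeal.inertiaDeg (𝓞 F))).map (μ.valueAtUniformizer w * ·))
    (fun w hw => hupv w hw v α hw hα)
  have hkey := satakePolynomial_satakeTensor_eq_inducedSatakePolynomial (E := K) v
    (fun w => μ.valueAtUniformizer w) α β (hf v) (hμv β hβ)
  have e : δ = satakeTensor α β := by
    rw [← roots_satakePolynomial δ, ← roots_satakePolynomial (satakeTensor α β), hδpol, ← hkey]
  rwa [e] at hδ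

/-- **Lemma 3.1.1 (II), the symmetric case: `π` dihedral with respect to `K`, `π'` not**
(`π ⊠ π' = I_K^F(μ ⊗ π'_K)`; `t_π ⊗ t_{π'} = t_{π'} ⊗ t_π`, `satakeTensor_comm`).
[cite: Ramakrishnan2000, Lemma 3.1.1 (II) and Prop. 2.3.1] [cite: ArthurClozelAMS120, Ch. 3, Thm. 4.2 (a) and Thm. 6.2] -/
theorem Ramakrishnan2000_theoremM.existence_of_isQuadraticSelfTwistAE_left
    (hBC : baseChange_cyclic_cuspidal) (hAI : automorphicInduction_cyclic)
    (hLL : ∀ (F K : Type) [Field F] [NumberField F] [Field K] [NumberField K] [Algebra F K],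
      Module.finrank F K = 2 → ∀ (h2 : isCompact_glFiniteIntegralLevel 2 F)
        (π : CuspidalAutomorphicRepData 2 F h2), IsQuadraticSelfTwistAE K π.1 →
        ∃ μ : HeckeCharacter K, ∀ᶠ v : HeightOneSpectrum (𝓞 F) in cofinite, ∀ β : Multiset ℂ,
          π.1.HasSatakeParamAt v β →
            satakePolynomial β = inducedSatakePolynomial v (fun w => {μ.valueAtUniformizer w}))
    (F : Type) [Field F] [NumberField F]
    (h2 : isCompact_glFiniteIntegralLevel 2 F) (h4 : isCompact_glFiniteIntegralLevel 4 F)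
    (π π' : CuspidalAutomorphicRepData 2 F h2)
    (K : Type) [Field K] [NumberField K] [Algebra F K] (hK : Module.finrank F K = 2)
    (hπ : IsQuadraticSelfTwistAE K π.1) (hπ' : ¬ IsQuadraticSelfTwistAE K π'.1) :
    ∃ P : AutomorphicRepData (AutomorphyDatum.gl 4 F h4),
      ∀ᶠ v : HeightOneSpectrum (𝓞 F) in cofinite, ∀ α β : Multiset ℂ,
        π.1.HasSatakeParamAt v α → π'.1.HasSatakeParamAt v β →
          P.HasSatakeParamAt v (satakeTensor α β) := by
  obtain ⟨P, hP⟩ := Ramakrishnan2000_theoremM.existence_of_isQuadraticSelfTwistAE_right hBC hAI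
    hLL F h2 h4 π' π K hK hπ' hπ
  refine ⟨P, ?_⟩
  filter_upwards [hP] with v hv α β hα hβ
  rw [satakeTensor_comm]
  exact hv β α hβ hα

/-- **Lemma 3.1.1 (II) from the leaves, up to the doubly-dihedral case.** The hypothesis
`hDihedral` of `Ramakrishnan2000_theoremM.existence_of_leaves` (some quadratic `K/F` makes `π`
or `π'` an a.e. `ε_{K/F}`-self-twist ⟹ `π ⊠ π'` exists) follows from `baseChange_cyclic_cuspidal`,
`automorphicInduction_cyclic`, the Labesse–Langlands hypothesis `hLL`
(`existence_of_isQuadraticSelfTwistAE_right/left`) and the remaining case, stated inline: both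
`π` and `π'` are a.e. `ε_{K/F}`-self-twists for the *same* quadratic `K` (`hBoth`; op. cit.
Lemma 3.1.1 (II) with `π_K = ν ⊞ ν^θ` non-cuspidal: `π ⊠ π' = I_K^F(νμ) ⊞ I_K^F(νμ^θ)`, which
needs isobaric sums of automorphic inductions of characters).
[cite: Ramakrishnan2000, Lemma 3.1.1 (II)] -/
theorem Ramakrishnan2000_theoremM.existence_dihedral_of_leaves
    (hBC : baseChange_cyclic_cuspidal) (hAI : automorphicInduction_cyclic)
    (hLL : ∀ (F K : Type) [Field F] [NumberField F] [Field K] [NumberField K] [Algebra F K],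
      Module.finrank F K = 2 → ∀ (h2 : isCompact_glFiniteIntegralLevel 2 F)
        (π : CuspidalAutomorphicRepData 2 F h2), IsQuadraticSelfTwistAE K π.1 →
        ∃ μ : HeckeCharacter K, ∀ᶠ v : HeightOneSpectrum (𝓞 F) in cofinite, ∀ β : Multiset ℂ,
          π.1.HasSatakeParamAt v β →
            satakePolynomial β = inducedSatakePolynomial v (fun w => {μ.valueAtUniformizer w}))
    (hBoth : ∀ (F : Type) [Field F] [NumberField F]
      (h2 : isCompact_glFiniteIntegralLevel 2 F) (h4 : isCompact_glFiniteIntegralLevel 4 F)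
      (π π' : CuspidalAutomorphicRepData 2 F h2)
      (K : Type) [Field K] [NumberField K] [Algebra F K], Module.finrank F K = 2 →
      IsQuadraticSelfTwistAE K π.1 → IsQuadraticSelfTwistAE K π'.1 →
      ∃ P : AutomorphicRepData (AutomorphyDatum.gl 4 F h4),
        ∀ᶠ v : HeightOneSpectrum (𝓞 F) in cofinite, ∀ α β : Multiset ℂ,
          π.1.HasSatakeParamAt v α → π'.1.HasSatakeParamAt v β →
            P.HasSatakeParamAt v (satakeTensor α β))
    (F : Type) [Field F] [NumberField F]
    (h2 : isCompact_glFiniteIntegralLevel 2 F) (h4 : isCompact_glFiniteIntegralLevel 4 F)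
    (π π' : CuspidalAutomorphicRepData 2 F h2)
    (K : Type) [Field K] [NumberField K] [Algebra F K] (hK : Module.finrank F K = 2)
    (hor : IsQuadraticSelfTwistAE K π.1 ∨ IsQuadraticSelfTwistAE K π'.1) :
    ∃ P : AutomorphicRepData (AutomorphyDatum.gl 4 F h4),
      ∀ᶠ v : HeightOneSpectrum (𝓞 F) in cofinite, ∀ α β : Multiset ℂ,
        π.1.HasSatakeParamAt v α → π'.1.HasSatakeParamAt v β →
          P.HasSatakeParamAt v (satakeTensor α β) := by
  by_cases hπ : IsQuadraticSelfTwistAE K π.1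
  · by_cases hπ' : IsQuadraticSelfTwistAE K π'.1
    · exact hBoth F h2 h4 π π' K hK hπ hπ'
    · exact Ramakrishnan2000_theoremM.existence_of_isQuadraticSelfTwistAE_left hBC hAI hLL F h2 h4
        π π' K hK hπ hπ'
  · have hπ' : IsQuadraticSelfTwistAE K π'.1 := hor.resolve_left hπ
    exact Ramakrishnan2000_theoremM.existence_of_isQuadraticSelfTwistAE_right hBC hAI hLL F h2 h4
      π π' K hK hπ hπ'

end CaseII

/-! ### Theorem M from the leaves, with Lemma 3.1.1 (II) reduced to `hLL` and `hBoth` -/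

section Assembly2

open scoped Polynomial
open Polynomial

/-- **`Ramakrishnan2000_theoremM` from the leaves (second form).** As
`Ramakrishnan2000_theoremM.of_leaves`, with its hypothesis `hDihedral` (Lemma 3.1.1 (II))
discharged by `Ramakrishnan2000_theoremM.existence_dihedral_of_leaves`: Theorem M follows from the
named facts `Ramakrishnan2000_boxTimes_cuspidal` (general type), `GelbartJacquet_symmSq_cuspidal`
(case (III)), `baseChange_cyclic_cuspidal` and `automorphicInduction_cyclic` (case (II)),
Jacquet–Shalika (2.2)/(2.3) for Borel–Jacquet data and the Borel–Jacquet dictionary (the "only if"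
half and the central characters), together with the inline hypotheses `hIso` (isobaric sums,
Thm. 2.2.4), `hLL` (Labesse–Langlands on Satake polynomials, Prop. 2.3.1 (2)) and `hBoth` (the
doubly-dihedral sub-case of (II)) — see the module docstring.
[cite: Ramakrishnan2000, Theorem M (§3), Lemma 3.1.1, Thm. 2.2.4, Prop. 2.3.1 and Prop. 3.2.1]
[cite: ArthurClozelAMS120, Ch. 3, Thm. 4.2 (a) and Thm. 6.2] -/
theorem Ramakrishnan2000_theoremM.of_leaves'
    (hX : Ramakrishnan2000_boxTimes_cuspidal)
    (hGJ : GelbartJacquet_symmSq_cuspidal)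
    (hIso : ∀ (F : Type) [Field F] [NumberField F]
      (hF : ∀ m : ℕ, isCompact_glFiniteIntegralLevel m F) (n k : ℕ) (m : Fin k → ℕ)
      (σ : ∀ i : Fin k, CuspidalAutomorphicRepData (m i) F (hF (m i))), ∑ i, m i = n →
      ∃ P : AutomorphicRepData (AutomorphyDatum.gl n F (hF n)),
        ∀ᶠ v : HeightOneSpectrum (𝓞 F) in cofinite, ∀ β : Fin k → Multiset ℂ,
          (∀ i, (σ i).1.HasSatakeParamAt v (β i)) → P.HasSatakeParamAt v (∑ i, β i))
    (hBC : baseChange_cyclic_cuspidal) (hAI : automorphicInduction_cyclic)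
    (hLL : ∀ (F K : Type) [Field F] [NumberField F] [Field K] [NumberField K] [Algebra F K],
      Module.finrank F K = 2 → ∀ (h2 : isCompact_glFiniteIntegralLevel 2 F)
        (π : CuspidalAutomorphicRepData 2 F h2), IsQuadraticSelfTwistAE K π.1 →
        ∃ μ : HeckeCharacter K, ∀ᶠ v : HeightOneSpectrum (𝓞 F) in cofinite, ∀ β : Multiset ℂ,
          π.1.HasSatakeParamAt v β →
            satakePolynomial β = inducedSatakePolynomial v (fun w => {μ.valueAtUniformizer w}))
    (hBoth : ∀ (F : Type) [Field F] [NumberField F]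
      (h2 : isCompact_glFiniteIntegralLevel 2 F) (h4 : isCompact_glFiniteIntegralLevel 4 F)
      (π π' : CuspidalAutomorphicRepData 2 F h2)
      (K : Type) [Field K] [NumberField K] [Algebra F K], Module.finrank F K = 2 →
      IsQuadraticSelfTwistAE K π.1 → IsQuadraticSelfTwistAE K π'.1 →
      ∃ P : AutomorphicRepData (AutomorphyDatum.gl 4 F h4),
        ∀ᶠ v : HeightOneSpectrum (𝓞 F) in cofinite, ∀ α β : Multiset ℂ,
          π.1.HasSatakeParamAt v α → π'.1.HasSatakeParamAt v β →
            P.HasSatakeParamAt v (satakeTensor α β))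
    (h22 : JacquetShalika1981_partialPairL_boundary_repData)
    (h23 : JacquetShalika1981_partialPairL_pole_repData)
    (hA : ∀ {n : ℕ} {K : Type} [Field K] [NumberField K] (hK : isCompact_glFiniteIntegralLevel n K)
      (μ : Measure (gl n K).automorphicQuotient) [(gl n K).IsAutomorphicMeasure μ],
      AutomorphicRepsGL.exists_isAssociatedL2 hK μ)
    (hL2 : ∀ {n : ℕ} {K : Type} [Field K] [NumberField K] (hK : isCompact_glFiniteIntegralLevel n K)
      (μ : Measure (gl n K).automorphicQuotient) [(gl n K).IsAutomorphicMeasure μ],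
      hasSatakeParamAt_iff_L2 hK μ)
    (hss : ∀ {n : ℕ} {K : Type} [Field K] [NumberField K] (hK : isCompact_glFiniteIntegralLevel n K),
      AutomorphicRepsGL.stable_cuspidal_eq_sSup_irreducible hK) :
    Ramakrishnan2000_theoremM :=
  Ramakrishnan2000_theoremM.of_leaves hX hGJ hIso
    (fun F _ _ h2 h4 π π' K _ _ _ hK hor =>
      Ramakrishnan2000_theoremM.existence_dihedral_of_leaves hBC hAI hLL hBoth F h2 h4 π π' K hK
        hor)
    h22 h23 hA hL2 hss

end Assembly2

end Literature.NumberTheory.Automorphic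

end
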